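import Summits.ResolutionOfSingularities.ResolutionOfSingularities.Theorems.RadicialJungCleanModelsGiraudLogJacobianLocalization
import Summits.ResolutionOfSingularities.ResolutionOfSingularities.Theorems.RadicialJungCleanModelsNonPrincipalLocusFinite
import Mathlib.AlgebraicGeometry.AffineScheme
import HarnessLib

/-!
# Route `RadicialJung`, crux `CleanModels` (stmt-15917): finiteness of the Giraud-singular set FROM ADAPTED CHARTS —
# brick B3 / FILE 5 (step (S4) of `L/res-L1-s42-pv-2/w81-B3/B3-PLAN.md`) of T2-ARCHITECTURE

Support file (OURS) for PROGRAMME-clean-dim2 / T2 (`HOME/L/res-L0-w81-pv-2/g5/T2-ARCHITECTURE.md`, brick **B3**);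
seat res-L1-s42-pv-2 g7 (res-plan-2 IDLE POOL DEAL #50 (2)); line `via-clean-models` of the crux `DescentPerfectToAll`
(stmt-0549).  Nothing here is a statement of Hironaka's manuscript.  AI-written; AI review weaker than expert review.

ASSEMBLY of B3 modulo the chart construction (S1).  An ADAPTED CHART for `f` is an affine open `U = Spec A` with
`A` a noetherian domain of dimension `≤ 2` regular in codimension one, `Ω[A⁄ℤ]` projective, boundary equations
`x : Fin r → A` with dual derivations `∂_i x_j = δ_ij`, such that at EVERY point `ξ ∈ U` the critical primes of the
stalk `𝒪_{X,ξ}` at the germ of `f` are exactly the `(x_j)𝒪_{X,ξ}` with `x_j(ξ) = 0` («`E(f) ∩ U = V(x₁⋯x_r) ∩ U`»).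
On such a chart:
* `finite_setOf_giraudColength_ne_zero_of_chart` — **only finitely many points `ξ ∈ U` have `c(X, f, ξ) ≠ 0`**:
  the stalk is a localization of `A` at `primeIdealOf ξ` (`IsAffineOpen.isLocalization_stalk`), so by FILE 4
  (`giraudColength_eq_zero_of_isPrincipal_map`) `c(ξ) = 0` as soon as `J_A · A_𝔭` is principal, which fails only on
  FILE 3's finite set (`finite_setOf_not_isPrincipal_map_atPrime_of_isPrincipalIdealRing`); `ξ ↦ primeIdealOf ξ` is
  inverted by `fromSpec`.
* `finite_setOf_isGiraudSingularPoint_of_charts` — **B3 modulo (S1)**: if finitely many adapted charts cover `X`, the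
  Giraud-singular set of `f` is finite (a Giraud-singular point has `c ≠ 0` by definition).
Auxiliary: `isPrincipal_map_of_isLocalization_atPrime` (principality of `J·A_𝔭` does not depend on the model of the
localization).
-/

noncomputable section

set_option linter.dupNamespace false -- mandated namespace of this single-conjunct summit

open Literature.AlgebraicGeometry.Resolution AlgebraicGeometry CategoryTheory Opposite TopologicalSpace

namespace Summit.ResolutionOfSingularities.ResolutionOfSingularities.Theorems.RadicialJung.CleanModels

universe u

/-! ## Principality of `J · A_𝔭` is independent of the model of the localization -/

/-- If `J · A_𝔭` is principal in the standard localization, it is principal in any localization of `A` at `𝔭`. -/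
theorem isPrincipal_map_of_isLocalization_atPrime {A : Type u} [CommRing A] (p : Ideal A) [p.IsPrime]
    (S : Type u) [CommRing S] [Algebra A S] [IsLocalization.AtPrime S p] (J : Ideal A)
    (h : (J.map (algebraMap A (Localization.AtPrime p))).IsPrincipal) :
    (J.map (algebraMap A S)).IsPrincipal := by
  let e : Localization.AtPrime p ≃ₐ[A] S := IsLocalization.algEquiv p.primeCompl (Localization.AtPrime p) S
  have hcomp : (e : Localization.AtPrime p →+* S).comp (algebraMap A (Localization.AtPrime p)) = algebraMap A S :=
    e.toAlgHom.comp_algebraMap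
  have hmap : J.map (algebraMap A S) = (J.map (algebraMap A (Localization.AtPrime p))).map
      (e : Localization.AtPrime p →+* S) := by
    rw [Ideal.map_map, hcomp]
  obtain ⟨g, hg⟩ := h
  refine ⟨e g, ?_⟩
  rw [hmap, hg, Ideal.submodule_span_eq, Ideal.submodule_span_eq, Ideal.map_span, Set.image_singleton]
  rfl

/-! ## Finiteness on one adapted chart -/

section Chart

variable (X : Scheme.{u}) {U : X.Opens} (f : Γ(X, ⊤))

/-- The germ of `f` at `ξ ∈ U` is the germ of its restriction. -/
theorem germ_top_eq_germ_resTop {ξ : X} (hξ : ξ ∈ U) :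
    X.presheaf.germ ⊤ ξ trivial f = X.presheaf.germ U ξ hξ (X.presheaf.map (homOfLE le_top).op f) := by
  rw [TopCat.Presheaf.germ_res_apply]

/-- **On an adapted chart only finitely many points have nonzero Giraud colength.** -/
theorem finite_setOf_giraudColength_ne_zero_of_chart (hU : IsAffineOpen U)
    [IsDomain Γ(X, U)] [IsNoetherianRing Γ(X, U)] (hdim : ringKrullDim Γ(X, U) ≤ 2)
    (h1 : ∀ p : PrimeSpectrum Γ(X, U), p.asIdeal.height = 1 → IsPrincipalIdealRing (Localization.AtPrime p.asIdeal))
    (hproj : Module.Projective Γ(X, U) Ω[Γ(X, U)⁄ℤ])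
    {r : ℕ} (x : Fin r → Γ(X, U)) (δ : Fin r → Derivation ℤ Γ(X, U) Γ(X, U))
    (hδ : ∀ i j, δ i (x j) = if i = j then 1 else 0)
    (hcrit : ∀ (ξ : X) (hξ : ξ ∈ U), ∀ P : Ideal (X.presheaf.stalk ξ),
      P ∈ derivCriticalPrimes (X.presheaf.stalk ξ) (X.presheaf.germ ⊤ ξ trivial f) ↔
        ∃ j, ¬ IsUnit (X.presheaf.germ U ξ hξ (x j)) ∧ P = Ideal.span {X.presheaf.germ U ξ hξ (x j)}) :
    {ξ : X | ∃ _ : ξ ∈ U, giraudColength (X.presheaf.stalk ξ) (X.presheaf.germ ⊤ ξ trivial f) ≠ 0}.Finite := by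
  classical
  haveI := hproj
  -- the global log-content ideal of the chart
  let JA : Ideal Γ(X, U) :=
    Ideal.span {v : Γ(X, U) | ∃ D : Derivation ℤ Γ(X, U) Γ(X, U), (∀ j, x j ∣ D (x j)) ∧ D (X.presheaf.map (homOfLE le_top).op f) = v}
  -- FILE 3: its non-principal locus is finite
  have hfin := finite_setOf_not_isPrincipal_map_atPrime_of_isPrincipalIdealRing hdim JA h1
  -- our set is contained in the `fromSpec`-image of that locus
  refine (hfin.image fun p => (hU.fromSpec p : X)).subset ?_
  rintro ξ ⟨hξ, hc⟩
  refine ⟨hU.primeIdealOf ⟨ξ, hξ⟩, ?_, hU.fromSpec_primeIdealOf ⟨ξ, hξ⟩⟩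
  -- at `ξ`: the stalk is a localization at `primeIdealOf ξ`
  intro hprinc
  apply hc
  letI : Algebra Γ(X, U) (X.presheaf.stalk ξ) := X.presheaf.algebra_section_stalk (⟨ξ, hξ⟩ : (U : X.Opens))
  haveI : IsLocalization.AtPrime (X.presheaf.stalk ξ) (hU.primeIdealOf ⟨ξ, hξ⟩).asIdeal :=
    hU.isLocalization_stalk ⟨ξ, hξ⟩
  have halg : algebraMap Γ(X, U) (X.presheaf.stalk ξ) = (X.presheaf.germ U ξ hξ).hom :=
    TopCat.Presheaf.stalk_open_algebraMap X.presheaf ⟨ξ, hξ⟩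
  -- principality transported to the stalk
  have hprinc' : (JA.map (algebraMap Γ(X, U) (X.presheaf.stalk ξ))).IsPrincipal :=
    isPrincipal_map_of_isLocalization_atPrime (hU.primeIdealOf ⟨ξ, hξ⟩).asIdeal (X.presheaf.stalk ξ) JA hprinc
  -- the critical primes hypothesis in `algebraMap` form
  have hcrit' : ∀ P : Ideal (X.presheaf.stalk ξ),
      P ∈ derivCriticalPrimes (X.presheaf.stalk ξ) (algebraMap Γ(X, U) (X.presheaf.stalk ξ) (X.presheaf.map (homOfLE le_top).op f)) ↔
        ∃ j, ¬ IsUnit (algebraMap Γ(X, U) (X.presheaf.stalk ξ) (x j)) ∧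
          P = Ideal.span {algebraMap Γ(X, U) (X.presheaf.stalk ξ) (x j)} := by
    intro P
    rw [halg]
    change P ∈ derivCriticalPrimes _ (X.presheaf.germ U ξ hξ (X.presheaf.map (homOfLE le_top).op f)) ↔ _
    rw [← germ_top_eq_germ_resTop X f hξ]
    exact hcrit ξ hξ P
  have h0 := giraudColength_eq_zero_of_isPrincipal_map (X.presheaf.stalk ξ)
    (hU.primeIdealOf ⟨ξ, hξ⟩).asIdeal.primeCompl hδ (X.presheaf.map (homOfLE le_top).op f) hcrit' hprinc'
  rw [halg] at h0
  change giraudColength _ (X.presheaf.germ U ξ hξ (X.presheaf.map (homOfLE le_top).op f)) = 0 at h0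
  rwa [← germ_top_eq_germ_resTop X f hξ] at h0

end Chart

/-! ## B3 modulo the chart construction -/

/-- **B3 from finitely many adapted charts.**  If `X` is covered by finitely many affine opens each of which is an
adapted chart for `f` (noetherian domain of dimension `≤ 2` regular in codimension one, projective `Ω`, boundary
equations with dual derivations cutting out the critical primes of every stalk), then the set of Giraud-singular points
of `f` is finite. -/
theorem finite_setOf_isGiraudSingularPoint_of_charts (X : Scheme.{u}) (f : Γ(X, ⊤)) {ι : Type*} [Finite ι]
    (U : ι → X.Opens) (hU : ∀ i, IsAffineOpen (U i)) (hcover : ∀ ξ : X, ∃ i, ξ ∈ U i)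
    (hdom : ∀ i, IsDomain Γ(X, U i)) (hnoeth : ∀ i, IsNoetherianRing Γ(X, U i))
    (hdim : ∀ i, ringKrullDim Γ(X, U i) ≤ 2)
    (h1 : ∀ i, ∀ p : PrimeSpectrum Γ(X, U i), p.asIdeal.height = 1 →
      IsPrincipalIdealRing (Localization.AtPrime p.asIdeal))
    (hproj : ∀ i, Module.Projective Γ(X, U i) Ω[Γ(X, U i)⁄ℤ])
    (r : ι → ℕ) (x : ∀ i, Fin (r i) → Γ(X, U i)) (δ : ∀ i, Fin (r i) → Derivation ℤ Γ(X, U i) Γ(X, U i))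
    (hδ : ∀ i a b, δ i a (x i b) = if a = b then 1 else 0)
    (hcrit : ∀ i (ξ : X) (hξ : ξ ∈ U i), ∀ P : Ideal (X.presheaf.stalk ξ),
      P ∈ derivCriticalPrimes (X.presheaf.stalk ξ) (X.presheaf.germ ⊤ ξ trivial f) ↔
        ∃ j, ¬ IsUnit (X.presheaf.germ (U i) ξ hξ (x i j)) ∧ P = Ideal.span {X.presheaf.germ (U i) ξ hξ (x i j)}) :
    {ξ : X | IsGiraudSingularPoint X f ξ}.Finite := by
  have hfin : ∀ i, {ξ : X | ∃ _ : ξ ∈ U i,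
      giraudColength (X.presheaf.stalk ξ) (X.presheaf.germ ⊤ ξ trivial f) ≠ 0}.Finite := by
    intro i
    haveI := hdom i
    haveI := hnoeth i
    exact finite_setOf_giraudColength_ne_zero_of_chart X f (hU i) (hdim i) (h1 i) (hproj i) (x i) (δ i) (hδ i)
      (hcrit i)
  refine (Set.finite_iUnion hfin).subset fun ξ hξ => ?_
  obtain ⟨i, hi⟩ := hcover ξ
  exact Set.mem_iUnion.mpr ⟨i, hi, hξ.2.2.2⟩

end Summit.ResolutionOfSingularities.ResolutionOfSingularities.Theorems.RadicialJung.CleanModels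

end
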